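import Literature.Algebra.GroupRings.PassmanDihedralTypeGroupRings
import Mathlib.GroupTheory.SpecificGroups.Dihedral
import HarnessLib

/-!
# Lam §6 Exercise 6.14 (Wallace): the group algebra of the infinite dihedral group in characteristic `2` is J-semisimple

[cite: Lam2001FirstCourse, §6 Exercise 6.14, pp. 98–99]

Lam, *A First Course in Noncommutative Rings*, Exercises for §6 (pp. 98–99; p0110–p0111 of the held scan):

**Ex. 6.14.** (Wallace) Assume `char k = 2`, and let `G = A·⟨x⟩` as in Exercise 13, where `A` is the infinite cyclic group `⟨y⟩`. (`G` is
the infinite dihedral group.) Show that `R = kG` is J-semisimple (even though `G` has an element of order 2). (**Hint.** Let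
`Hᵢ = ⟨y^{3^i}⟩` (`1 ≤ i < ∞`) and note that `Gᵢ = G/Hᵢ` is a dihedral group of order `2·3^i`. Show that `φ : kG → ∏ᵢ kGᵢ` is injective.
By part (1) of Exercise 13, `(rad kGᵢ)² = 0`. Deduce that `(rad kG)² = 0` and conclude from part (2) of Exercise 13 that `rad kG = 0`.)

§1 runs the hint for any `G = A ⋊ ⟨x⟩` as in Exercise 6.13 (`A` infinite) equipped with a separating family of homomorphisms `fⱼ` onto
FINITE groups with `ker fⱼ ≤ A` and `A/(A ∩ ker fⱼ)` without `2`-torsion (the `G → Gᵢ` of the hint): `fⱼ(rad kG) ⊆ rad kQⱼ` has square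
zero by Exercise 6.13 (1), the `fⱼ` separate the finitely many group elements involved in a product `rs` (`r, s ∈ rad kG`), so `rs = 0`;
thus `rad kG` is nil and Exercise 6.13 (2) gives `rad kG = 0` (`jacobson_eq_bot_of_separating_family`).  §2 is the printed case:
`G = DihedralGroup 0` (Mathlib's infinite dihedral group, `A` = the rotations `r i`, `x = sr 0`), with the reductions
`DihedralGroup 0 → DihedralGroup (2m+1)` (all odd moduli instead of the powers of `3`): `jacobson_dihedralGroup_zero_eq_bot`.

## References

* [Lam2001FirstCourse] T. Y. Lam, *A First Course in Noncommutative Rings*, 2nd ed., Graduate Texts in Mathematics 131, Springer, 2001,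
  §6 Exercise 6.14, pp. 98–99 (held scan `book:lamnd-first-course-noncommutative-rings`, p0110–p0111).
-/

universe u w w'

namespace Literature.Algebra.GroupRings

open MonoidAlgebra

/-! ## §1 The hint, for a separating family of finite dihedral-type quotients -/

section Family

variable {k : Type u} [CommRing k] {G : Type w} [Group G] {H : Type w'} [Group H]

/-- `kG → kH` is onto for `G ↠ H`. [cite: Lam2001FirstCourse, §6 Exercise 6.14 (Hint: «`G_i = G/H_i`»)] -/
theorem mapDomainRingHom_surjective (f : G →* H) (hf : Function.Surjective f) :
    Function.Surjective (mapDomainRingHom k f) := fun y ↦ by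
  induction y using MonoidAlgebra.induction_linear with
  | zero => exact ⟨0, map_zero _⟩
  | add y z hy hz =>
    obtain ⟨a, rfl⟩ := hy
    obtain ⟨b, rfl⟩ := hz
    exact ⟨a + b, map_add _ _ _⟩
  | single h c =>
    obtain ⟨g, rfl⟩ := hf h
    exact ⟨single g c, by change mapDomain f (single g c) = _; exact mapDomain_single⟩

/-- The image of `rad kG` under `kG ↠ kH` lies in `rad kH`. [cite: Lam2001FirstCourse, §6 Exercise 6.14 (Hint); §4 Prop. (4.6)] -/
theorem mapDomainRingHom_mem_jacobson (f : G →* H) (hf : Function.Surjective f) {r : MonoidAlgebra k G}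
    (hr : r ∈ Ring.jacobson (MonoidAlgebra k G)) : mapDomainRingHom k f r ∈ Ring.jacobson (MonoidAlgebra k H) := by
  haveI : RingHomSurjective (mapDomainRingHom k f) := ⟨mapDomainRingHom_surjective f hf⟩
  exact Ideal.mem_comap.1 (Ring.le_comap_jacobson (mapDomainRingHom k f) hr)

variable (A : Subgroup G) [IsMulCommutative A] {x : G}

/-- Transfer of the Exercise 6.13 set-up `G = A ⋊ ⟨x⟩` along `f : G ↠ H` with `ker f ≤ A` and `A/(A ∩ ker f)` `2`-torsion-free, and
Exercise 6.13 (1) there: `(rad kH)² = 0` («`G_i` is a dihedral group … By part (1) of Exercise 13, `(rad kG_i)² = 0`»).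
[cite: Lam2001FirstCourse, §6 Exercise 6.14 (Hint)] -/
theorem jacobson_mul_jacobson_eq_bot_of_surjective {k : Type u} [Field k] [CharP k 2] [Finite H] (hx2 : x * x = 1) (hx : x ∉ A)
    (hxA : ∀ a ∈ A, x * a * x⁻¹ = a⁻¹) (hcov : ∀ g : G, g ∈ A ∨ g * x ∈ A) (f : G →* H) (hf : Function.Surjective f)
    (hker : f.ker ≤ A) (h2 : ∀ a ∈ A, a * a ∈ f.ker → a ∈ f.ker) :
    Ring.jacobson (MonoidAlgebra k H) * Ring.jacobson (MonoidAlgebra k H) = ⊥ := by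
  haveI : Fintype H := Fintype.ofFinite H
  have hx2' : f x * f x = 1 := by rw [← map_mul, hx2, map_one]
  have hx' : f x ∉ A.map f := fun hmem ↦ by
    obtain ⟨a, ha, hfa⟩ := Subgroup.mem_map.1 hmem
    have h1 : a⁻¹ * x ∈ f.ker := by rw [MonoidHom.mem_ker, map_mul, map_inv, hfa, inv_mul_cancel]
    exact hx (by simpa using A.mul_mem ha (hker h1))
  have hxA' : ∀ a' ∈ A.map f, f x * a' * (f x)⁻¹ = a'⁻¹ := fun a' ha' ↦ by
    obtain ⟨a, ha, rfl⟩ := Subgroup.mem_map.1 ha'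
    rw [← map_inv f x, ← map_mul, ← map_mul, hxA a ha, map_inv]
  have hcov' : ∀ q : H, q ∈ A.map f ∨ q * f x ∈ A.map f := fun q ↦ by
    obtain ⟨g, rfl⟩ := hf q
    rcases hcov g with hg | hg
    · exact Or.inl (Subgroup.mem_map_of_mem f hg)
    · rw [← map_mul]
      exact Or.inr (Subgroup.mem_map_of_mem f hg)
  have hA2' : ∀ a' ∈ A.map f, orderOf a' ≠ 2 := fun a' ha' h ↦ by
    obtain ⟨a, ha, rfl⟩ := Subgroup.mem_map.1 ha'
    have h1 : f (a * a) = 1 := by rw [map_mul, ← pow_two, ← h]; exact pow_orderOf_eq_one _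
    have h3 : f a = 1 := h2 a ha h1
    rw [h3, orderOf_one] at h
    exact absurd h (by decide)
  exact jacobson_mul_jacobson_eq_bot (A.map f) hA2' hx2' hx' hxA' hcov'

omit [IsMulCommutative A] in
/-- **Injectivity of `φ : kG → ∏ⱼ kQⱼ`**: if the `fⱼ` separate every finite set of non-identity elements of `G`, an element of `kG` killed
by all `kG → kQⱼ` is `0`. [cite: Lam2001FirstCourse, §6 Exercise 6.14 (Hint: «Show that `φ : kG → ∏ᵢ kGᵢ` is injective»)] -/
theorem eq_zero_of_forall_mapDomainRingHom_eq_zero {ι : Type*} {Q : ι → Type w'} [∀ j, Group (Q j)] (f : ∀ j, G →* Q j)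
    (hsep : ∀ F : Finset G, (∀ g ∈ F, g ≠ 1) → ∃ j, ∀ g ∈ F, f j g ≠ 1) {z : MonoidAlgebra k G}
    (hz : ∀ j, mapDomainRingHom k (f j) z = 0) : z = 0 := by
  classical
  set S : Finset G := z.coeff.support with hS
  obtain ⟨j, hj⟩ := hsep (((S ×ˢ S).image fun p : G × G ↦ p.1⁻¹ * p.2).filter (· ≠ 1)) fun g hg ↦ (Finset.mem_filter.1 hg).2
  -- `f j` is injective on the support of `z`
  have hinj : Set.InjOn (f j) (S : Set G) := fun g hg g' hg' hgg' ↦ by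
    by_contra hne
    have hmem : g⁻¹ * g' ∈ ((S ×ˢ S).image fun p : G × G ↦ p.1⁻¹ * p.2).filter (· ≠ 1) :=
      Finset.mem_filter.2 ⟨Finset.mem_image.2 ⟨(g, g'), Finset.mem_product.2 ⟨hg, hg'⟩, rfl⟩,
        fun h ↦ hne (inv_mul_eq_one.1 h)⟩
    exact hj _ hmem (by rw [map_mul, map_inv, hgg', inv_mul_cancel])
  refine coeff_inj.1 (Finsupp.ext fun g ↦ ?_)
  rw [coeff_zero, Finsupp.zero_apply]
  by_contra hg
  have hgS : g ∈ (S : Set G) := Finset.mem_coe.2 (Finsupp.mem_support_iff.2 hg)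
  have h1 : (mapDomainRingHom k (f j) z).coeff (f j g) = z.coeff g := by
    change (Finsupp.mapDomain (f j) z.coeff) (f j g) = _
    exact Finsupp.mapDomain_apply' (S : Set G) z.coeff subset_rfl hinj hgS
  rw [hz j, coeff_zero, Finsupp.zero_apply] at h1
  exact hg h1.symm

/-- **LAM Exercise 6.14, the hint in general: `char k = 2` (`k` a field), `G = A ⋊ ⟨x⟩` as in Exercise 6.13 with `A` INFINITE, and a
separating family of maps `fⱼ : G ↠ Qⱼ` onto finite groups with `ker fⱼ ≤ A` and `A/ker fⱼ` without `2`-torsion (the `G/Hᵢ` of the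
hint) ⟹ `rad kG = 0`**: `(rad kQⱼ)² = 0` by Exercise 6.13 (1), so `(rad kG)² = 0` by injectivity of `kG → ∏ kQⱼ`, and Exercise
6.13 (2) kills the nil ideal `rad kG`. [cite: Lam2001FirstCourse, §6 Exercise 6.14 (Hint)] -/
theorem jacobson_eq_bot_of_separating_family {k : Type u} [Field k] [CharP k 2] (hA2 : ∀ a ∈ A, orderOf a ≠ 2)
    (hinf : (A : Set G).Infinite) (hx2 : x * x = 1) (hx : x ∉ A) (hxA : ∀ a ∈ A, x * a * x⁻¹ = a⁻¹)
    (hcov : ∀ g : G, g ∈ A ∨ g * x ∈ A) {ι : Type*} {Q : ι → Type w'} [∀ j, Group (Q j)] [∀ j, Finite (Q j)] (f : ∀ j, G →* Q j)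
    (hf : ∀ j, Function.Surjective (f j)) (hker : ∀ j, (f j).ker ≤ A) (h2 : ∀ j, ∀ a ∈ A, a * a ∈ (f j).ker → a ∈ (f j).ker)
    (hsep : ∀ F : Finset G, (∀ g ∈ F, g ≠ 1) → ∃ j, ∀ g ∈ F, f j g ≠ 1) :
    Ring.jacobson (MonoidAlgebra k G) = ⊥ := by
  -- `(rad kG)² = 0`
  have hsq : ∀ r ∈ Ring.jacobson (MonoidAlgebra k G), ∀ s ∈ Ring.jacobson (MonoidAlgebra k G), r * s = 0 := fun r hr s hs ↦ by
    refine eq_zero_of_forall_mapDomainRingHom_eq_zero f hsep fun j ↦ ?_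
    have h := jacobson_mul_jacobson_eq_bot_of_surjective A hx2 hx hxA hcov (f j) (hf j) (hker j) (h2 j) (k := k)
    rw [map_mul, ← Ideal.mem_bot, ← h]
    exact Ideal.mul_mem_mul (mapDomainRingHom_mem_jacobson (f j) (hf j) hr) (mapDomainRingHom_mem_jacobson (f j) (hf j) hs)
  -- so `rad kG` is nil, hence `0` by Exercise 6.13 (2)
  exact eq_bot_of_nil_of_infinite A hA2 hinf hx2 hxA hcov (Ring.jacobson (MonoidAlgebra k G)) fun r hr ↦ ⟨2, by rw [pow_two, hsq r hr r hr]⟩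

end Family

/-! ## §2 The infinite dihedral group `D_∞ = DihedralGroup 0` -/

section Dihedral

open DihedralGroup

/-- The rotation subgroup `A = ⟨y⟩ = {r i}` of `D_∞`, `y = r 1`: membership. [cite: Lam2001FirstCourse, §6 Exercise 6.14] -/
theorem mem_zpowers_r_one_iff (g : DihedralGroup 0) : g ∈ Subgroup.zpowers (r (1 : ZMod 0)) ↔ ∃ i, g = r i := by
  constructor
  · intro h
    obtain ⟨j, hj⟩ := Subgroup.mem_zpowers_iff.1 h
    exact ⟨j, by rw [← hj, r_one_zpow]; rfl⟩
  · rintro ⟨i, rfl⟩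
    exact Subgroup.mem_zpowers_iff.2 ⟨i, by rw [r_one_zpow]; rfl⟩

/-- The reduction `D_∞ → D_n`, `r i ↦ r ī`, `sr i ↦ sr ī`. [cite: Lam2001FirstCourse, §6 Exercise 6.14 (Hint: «`G_i = G/H_i` is a
dihedral group»)] -/
theorem exists_hom_dihedralGroup (n : ℕ) : ∃ f : DihedralGroup 0 →* DihedralGroup n, (∀ i : ZMod 0, f (r i) = r (ZMod.cast i)) ∧
    ∀ i : ZMod 0, f (sr i) = sr (ZMod.cast i) := by
  let c : ZMod 0 →+* ZMod n := ZMod.castHom (dvd_zero n) (ZMod n)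
  have hc : ∀ i, c i = ZMod.cast i := fun _ ↦ rfl
  let φ : DihedralGroup 0 → DihedralGroup n := fun g ↦ match g with
    | r i => r (c i)
    | sr i => sr (c i)
  refine ⟨MonoidHom.mk' φ ?_, fun i ↦ by rw [MonoidHom.mk'_apply, ← hc], fun i ↦ by rw [MonoidHom.mk'_apply, ← hc]⟩
  rintro (i | i) (j | j) <;> simp only [φ, r_mul_r, r_mul_sr, sr_mul_r, sr_mul_sr, map_add, map_sub]

/-- **LAM Exercise 6.14 (WALLACE): for a field `k` of characteristic `2`, the group algebra of the infinite dihedral group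
`D_∞ = ⟨y⟩ ⋊ ⟨x⟩` is J-semisimple — although `x` has order `2`.** [cite: Lam2001FirstCourse, §6 Exercise 6.14] -/
theorem jacobson_dihedralGroup_zero_eq_bot (k : Type u) [Field k] [CharP k 2] : Ring.jacobson (MonoidAlgebra k (DihedralGroup 0)) = ⊥ := by
  classical
  set A : Subgroup (DihedralGroup 0) := Subgroup.zpowers (r (1 : ZMod 0)) with hA
  have hmem : ∀ g : DihedralGroup 0, g ∈ A ↔ ∃ i, g = r i := mem_zpowers_r_one_iff
  have hr : ∀ i : ZMod 0, r i ∈ A := fun i ↦ (hmem _).2 ⟨i, rfl⟩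
  have hsr : ∀ i : ZMod 0, sr i ∉ A := fun i h ↦ by
    obtain ⟨j, hj⟩ := (hmem _).1 h
    cases hj
  -- the Exercise 6.13 set-up with `x = sr 0`
  have hA2 : ∀ a ∈ A, orderOf a ≠ 2 := fun a ha h ↦ by
    obtain ⟨i, rfl⟩ := (hmem a).1 ha
    have h1 : (r i : DihedralGroup 0) ^ 2 = 1 := by rw [← h]; exact pow_orderOf_eq_one _
    rw [r_pow, DihedralGroup.one_def] at h1
    have h2 : (i : ℤ) * 2 = 0 := r.inj h1
    have hi : i = 0 := by
      rcases mul_eq_zero.1 h2 with h3 | h3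
      · exact h3
      · norm_num at h3
    rw [hi, r_zero, orderOf_one] at h
    exact absurd h (by decide)
  have hinf : (A : Set (DihedralGroup 0)).Infinite :=
    Set.infinite_of_injective_forall_mem (f := fun i : ℤ ↦ (r (i : ZMod 0) : DihedralGroup 0)) (fun i j h ↦ r.inj h) fun i ↦ hr i
  have hx2 : (sr 0 : DihedralGroup 0) * sr 0 = 1 := sr_mul_self 0
  have hxA : ∀ a ∈ A, (sr 0 : DihedralGroup 0) * a * (sr 0)⁻¹ = a⁻¹ := fun a ha ↦ by
    obtain ⟨i, rfl⟩ := (hmem a).1 ha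
    rw [inv_sr, sr_mul_r, sr_mul_sr, inv_r, zero_add, zero_sub]
  have hcov : ∀ g : DihedralGroup 0, g ∈ A ∨ g * sr 0 ∈ A := by
    rintro (i | i)
    · exact Or.inl (hr i)
    · exact Or.inr (by rw [sr_mul_sr]; exact hr _)
  -- the reductions `D_∞ → D_{2m+1}`
  choose f hfr hfsr using fun m : ℕ ↦ exists_hom_dihedralGroup (2 * m + 1)
  have hcast0 : ∀ (m : ℕ) (i : ZMod 0), (ZMod.cast i : ZMod (2 * m + 1)) = 0 ↔ ((2 * m + 1 : ℕ) : ℤ) ∣ i := fun m i ↦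
    ZMod.intCast_zmod_eq_zero_iff_dvd i (2 * m + 1)
  have hf : ∀ m, Function.Surjective (f m) := fun m q ↦ by
    rcases q with i | i
    · obtain ⟨j, rfl⟩ := ZMod.intCast_surjective i
      exact ⟨r j, hfr m j⟩
    · obtain ⟨j, rfl⟩ := ZMod.intCast_surjective i
      exact ⟨sr j, hfsr m j⟩
  have hker : ∀ m, (f m).ker ≤ A := fun m g hg ↦ by
    rcases g with i | i
    · exact hr i
    · rw [MonoidHom.mem_ker, hfsr, DihedralGroup.one_def] at hg
      cases hg
  have hker_r : ∀ (m : ℕ) (i : ZMod 0), r i ∈ (f m).ker ↔ ((2 * m + 1 : ℕ) : ℤ) ∣ i := fun m i ↦ by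
    rw [MonoidHom.mem_ker, hfr, DihedralGroup.one_def, ← hcast0]
    exact ⟨fun h ↦ r.inj h, fun h ↦ by rw [h]⟩
  have h2 : ∀ m, ∀ a ∈ A, a * a ∈ (f m).ker → a ∈ (f m).ker := fun m a ha haa ↦ by
    obtain ⟨i, rfl⟩ := (hmem a).1 ha
    rw [r_mul_r, hker_r] at haa
    rw [hker_r]
    have hgcd : Int.gcd ((2 * m + 1 : ℕ) : ℤ) 2 = 1 := by
      rw [show (2 : ℤ) = ((2 : ℕ) : ℤ) from rfl, Int.gcd_natCast_natCast]
      exact Nat.coprime_two_right.2 ⟨m, rfl⟩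
    exact Int.dvd_of_dvd_mul_right_of_gcd_one (by rwa [← two_mul] at haa) hgcd
  have hsep : ∀ F : Finset (DihedralGroup 0), (∀ g ∈ F, g ≠ 1) → ∃ m, ∀ g ∈ F, f m g ≠ 1 := fun F hF ↦ by
    -- a modulus exceeding all `|i|`, `r i ∈ F`
    let ν : DihedralGroup 0 → ℕ := fun g ↦ match g with
      | r i => Int.natAbs i
      | sr _ => 0
    refine ⟨F.sup ν, fun g hg ↦ ?_⟩
    have hle : ν g ≤ F.sup ν := Finset.le_sup hg
    rcases g with i | i
    · rw [hfr, DihedralGroup.one_def]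
      intro h
      have hdvd : ((2 * F.sup ν + 1 : ℕ) : ℤ) ∣ i := (hcast0 _ i).1 (r.inj h)
      have hi : (i : ℤ) = 0 := Int.eq_zero_of_dvd_of_natAbs_lt_natAbs hdvd (by
        rw [Int.natAbs_natCast]
        change Int.natAbs i ≤ F.sup ν at hle
        omega)
      exact hF _ hg (by rw [hi]; exact r_zero)
    · rw [hfsr, DihedralGroup.one_def]
      intro h
      cases h
  exact jacobson_eq_bot_of_separating_family A hA2 hinf hx2 (hsr 0) hxA hcov f hf hker h2 hsep

end Dihedral

end Literature.Algebra.GroupRings
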